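import Summits.QuantumFields.BalabanUV.Beta.GAN24.LegPushNestAux
import Summits.QuantumFields.BalabanUV.Beta.MixedWardPackingFF

/-!
# `BalabanUV.Beta.GAN24.LegPushGaugeSplit` — binder row G-an2-4 ∕ (CONV-C), W-slot, the (α-0) parity re-cut, located crux (Q-L-k₀) (RULING R-gan24p1-g36-1 (4d):
# «the slot legs' dressings `dz·(…)` go BY PARTS onto the slot divergences»): **A PURE-GAUGE SLOT LEG PAIRS WITH THE SLOT DIVERGENCE** —
# `vertexW (dz φ) S μ y = Σ'_w φ μ y w • divV S w` (summation by parts in the slot variable), and the double vertex through DRESSED slot legs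
# `r + dz φ` splits into the double vertex through `r` plus two gauge pairings with the table's slot divergences (`KernelWard.divV ∕ divW`).

NOT IN PRINT; OUR BOOKKEEPING ([folklore] summation by parts + absolutely convergent re-bracketing; 0 `def`, 0 cited facts, 0 `def … : Prop`, 0 sorry, 0 wall
binders).  HONEST FRAMING (cell contract, verbatim): «discharging `BetaPertH` makes Bałaban's UV stability UNCONDITIONAL — a real constructive-QFT result; it is
NOT the continuum limit and NOT the Clay problem.»  HONEST DEPENDENCY (verbatim): «continuum YM on T⁴ ⇐ BetaPertH ∧ nine spine estimates (0/9 proved); BetaPertH ⇐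
(D1) ∧ (D4) ∧ CAP+tail; G-an2-4 gates asym, D1 and NE2/3/4.»

## What is proved (generic `d`)
* §1 `vertexW_add_legs` (the vertex is additive in the leg family on bounded tables), **`vertexW_gaugeLeg`** — for a summable gauge potential `φ μ y : Site → ℝ` per
  coarse bond and a bounded first-order family `S`: `vertexW (fun μ y κ v ↦ φ μ y (v + e_κ) − φ μ y v) S μ y = fun x z a b ↦ Σ'_w φ μ y w · divV S w x z a b`.
* §2 **`vertexW_dressed_eq`** — `vertexW (r + dz φ) S μ y = vertexW r S μ y + (Σ'_w φ μ y w • divV S w)`: the DRESSED slot leg = the smooth leg + the gauge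
  pairing with the slot divergence — the by-parts half of RULING R-gan24p1-g36-1 (4d); with leaf-01 g44 ∕ leaf-03 g41's (b1) `legAct_legChain_respStepBm`
  (`T^E = Π_bm T^B + dz·Psi = T^B + dz·(Psi − bmGaugeAt ρ T^B Lc)`) this is how the composite dressed slot legs of the (Q-L-k₀) window enter the three-leg core:
  the smooth part `T^B` (leaf-12's envelopes) carries the double freezing of `ThreeLegDoubleFreeze`, the gauge part meets the slot DIVERGENCES = the GoodL currency.
* §3 `vertexW_add_table`, (`divV_add` BY NAME from `Beta.MixedWardPackingFF`), **`vertex2W_dressed_eq`** — both slots dressed: the double vertex = the smooth double vertex + THREE gauge pairings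
  with the table's slot divergences.  The crude `sup × divergence-row` bounds of the pairings and their packaging for `legPush` are the next file.  Asserts NOTHING about Bałaban's tables; NOT (H1♮); discharges NOTHING of (Q-L) ∕ (C) ∕ «T2Shape» ∕ «T2Drift» ∕ (hW, hWall); NEVER «G-an2-4 closed» as
(CONV-C); NOT D1, NOT `BetaPertH`, NOT continuum, NOT Clay; not in print.
Unit `b2b-balaban-gan24-formalise-leaf-01` (G-an2-4 formalisation swarm, leaf prover 01, gen 74), 2026-08-23.
-/

noncomputable section

open Finset
open scoped BigOperators
open Literature.MathematicalPhysics.QuantumFieldTheory.Balaban1983to89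
open Literature.MathematicalPhysics.QuantumFieldTheory.Balaban1983to89.Beta
open B6BondElimination (unitVec)
open ExpKernelCalculus (MKer)
open OneStepResolventKernel (Fib)
open KernelWard (divV)
open Summit.QuantumFields.BalabanUV.Beta.MixedWardPackingFF (divV_add)
open Summit.QuantumFields.BalabanUV.Beta.GAN24.Push4 (vertexW vertexW_apply)

namespace Summit.QuantumFields.BalabanUV.Beta.GAN24.LegPushGaugeSplit

variable {d : ℕ}

/-! ## §1 Additivity in the legs; the gauge leg pairs with the slot divergence -/

/-- [folklore] `divV` read entrywise. -/
theorem divV_apply_entry (S : Fin (d + 1) → (Fin (d + 1) → ℤ) → MKer (d + 1) (Fib d)) (y : Fin (d + 1) → ℤ) (x z : Fin (d + 1) → ℤ) (a b : Fib d) :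
    divV S y x z a b = ∑ μ, (S μ (y - unitVec μ) x z a b - S μ y x z a b) := by
  simp only [divV, Finset.sum_apply, Pi.sub_apply]

/-- [folklore] **THE VERTEX IS ADDITIVE IN THE LEG FAMILY** on tables against which both legs are summable. -/
theorem vertexW_add_legs {r₁ r₂ : Fin (d + 1) → (Fin (d + 1) → ℤ) → Fin (d + 1) → (Fin (d + 1) → ℤ) → ℝ} {S : Fin (d + 1) → (Fin (d + 1) → ℤ) → MKer (d + 1) (Fib d)} {μ : Fin (d + 1)} {y : Fin (d + 1) → ℤ}
    (h₁ : ∀ κ x z a b, Summable fun v => r₁ μ y κ v * S κ v x z a b) (h₂ : ∀ κ x z a b, Summable fun v => r₂ μ y κ v * S κ v x z a b) :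
    vertexW (fun μ y κ v => r₁ μ y κ v + r₂ μ y κ v) S μ y = vertexW r₁ S μ y + vertexW r₂ S μ y := by
  funext x z a b
  simp only [vertexW_apply, Pi.add_apply, ← Finset.sum_add_distrib]
  refine Finset.sum_congr rfl fun κ _ => ?_
  rw [← (h₁ κ x z a b).tsum_add (h₂ κ x z a b)]
  exact tsum_congr fun v => by ring

/-- [folklore] **A PURE-GAUGE SLOT LEG PAIRS WITH THE SLOT DIVERGENCE** (summation by parts in the slot variable): for a gauge potential `φ μ y` summable in the fine
slot position (per coarse bond) and a bounded first-order family `S`,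
`vertexW (fun μ y κ v ↦ φ μ y (v + e_κ) − φ μ y v) S μ y = fun x z a b ↦ Σ'_w φ μ y w · divV S w x z a b`. -/
theorem vertexW_gaugeLeg {φ : Fin (d + 1) → (Fin (d + 1) → ℤ) → (Fin (d + 1) → ℤ) → ℝ} {S : Fin (d + 1) → (Fin (d + 1) → ℤ) → MKer (d + 1) (Fib d)} {CS : ℝ}
    (hφ : ∀ μ y, Summable fun v => φ μ y v) (hS : ∀ κ v x z a b, |S κ v x z a b| ≤ CS) (μ : Fin (d + 1)) (y : Fin (d + 1) → ℤ) :
    vertexW (fun μ y κ v => φ μ y (v + unitVec κ) - φ μ y v) S μ y = fun x z a b => ∑' w, φ μ y w * divV S w x z a b := by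
  funext x z a b
  rw [vertexW_apply]
  -- summabilities: a summable potential (and its shift) against bounded slices
  have hsum : ∀ (κ : Fin (d + 1)) (F : (Fin (d + 1) → ℤ) → ℝ) (M : ℝ), (∀ v, |F v| ≤ M) → ∀ (g : (Fin (d + 1) → ℤ) → ℝ), Summable g →
      Summable fun v => g v * F v := by
    intro κ F M hF g hg
    refine Summable.of_norm_bounded (hg.abs.mul_right M) fun v => ?_
    rw [Real.norm_eq_abs, abs_mul]
    exact mul_le_mul_of_nonneg_left (hF v) (abs_nonneg _)
  have hshift : ∀ κ, Summable fun v => φ μ y (v + unitVec κ) := fun κ =>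
    (hφ μ y).comp_injective (add_left_injective (unitVec κ))
  -- per direction: split, shift the first series back by `e_κ`
  have hκ : ∀ κ, (∑' v, (φ μ y (v + unitVec κ) - φ μ y v) * S κ v x z a b)
      = ∑' w, φ μ y w * (S κ (w - unitVec κ) x z a b - S κ w x z a b) := by
    intro κ
    have hA := hsum κ (fun v => S κ v x z a b) CS (fun v => hS κ v x z a b) _ (hshift κ)
    have hB := hsum κ (fun v => S κ v x z a b) CS (fun v => hS κ v x z a b) _ (hφ μ y)
    have hA' : Summable fun w => φ μ y w * S κ (w - unitVec κ) x z a b :=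
      hsum κ (fun w => S κ (w - unitVec κ) x z a b) CS (fun w => hS κ _ x z a b) _ (hφ μ y)
    have e1 : (∑' v, (φ μ y (v + unitVec κ) - φ μ y v) * S κ v x z a b)
        = (∑' v, φ μ y (v + unitVec κ) * S κ v x z a b) - ∑' v, φ μ y v * S κ v x z a b := by
      rw [← hA.tsum_sub hB]; exact tsum_congr fun v => by ring
    have e2 : (∑' v, φ μ y (v + unitVec κ) * S κ v x z a b) = ∑' w, φ μ y w * S κ (w - unitVec κ) x z a b := by
      rw [← (Equiv.subRight (unitVec κ)).tsum_eq (fun v => φ μ y (v + unitVec κ) * S κ v x z a b)]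
      exact tsum_congr fun w => by simp only [Equiv.subRight_apply, sub_add_cancel]
    rw [e1, e2, ← hA'.tsum_sub hB]
    exact tsum_congr fun w => by ring
  simp_rw [hκ]
  -- reassemble the direction sum inside the position series
  have hS' : ∀ κ, Summable fun w => φ μ y w * (S κ (w - unitVec κ) x z a b - S κ w x z a b) := by
    intro κ
    have hCS : 0 ≤ CS := (abs_nonneg _).trans (hS 0 0 0 0 (Sum.inl 0) (Sum.inl 0))
    exact hsum κ _ (CS + CS) (fun w => (abs_sub _ _).trans (add_le_add (hS κ _ x z a b) (hS κ w x z a b))) _ (hφ μ y)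
  rw [← Summable.tsum_finsetSum (fun κ _ => hS' κ)]
  refine tsum_congr fun w => ?_
  rw [divV_apply_entry, Finset.mul_sum]

/-! ## §2 The dressed slot leg = smooth leg + gauge pairing -/

/-- NOT IN PRINT; OUR BOOKKEEPING.  **THE DRESSED SLOT LEG SPLITS**: for a leg family `r` summable in its fine index, a summable gauge potential `φ` and a bounded
first-order family `S`, `vertexW (fun μ y κ v ↦ r μ y κ v + (φ μ y (v + e_κ) − φ μ y v)) S μ y = vertexW r S μ y + (fun x z a b ↦ Σ'_w φ μ y w · divV S w x z a b)`
— the smooth part keeps the vertex, the gauge part meets the slot divergence (RULING R-gan24p1-g36-1 (4d)). -/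
theorem vertexW_dressed_eq {r : Fin (d + 1) → (Fin (d + 1) → ℤ) → Fin (d + 1) → (Fin (d + 1) → ℤ) → ℝ} {φ : Fin (d + 1) → (Fin (d + 1) → ℤ) → (Fin (d + 1) → ℤ) → ℝ}
    {S : Fin (d + 1) → (Fin (d + 1) → ℤ) → MKer (d + 1) (Fib d)} {CS : ℝ}
    (hrs : ∀ μ y κ, Summable fun v => r μ y κ v) (hφ : ∀ μ y, Summable fun v => φ μ y v) (hS : ∀ κ v x z a b, |S κ v x z a b| ≤ CS)
    (μ : Fin (d + 1)) (y : Fin (d + 1) → ℤ) :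
    vertexW (fun μ y κ v => r μ y κ v + (φ μ y (v + unitVec κ) - φ μ y v)) S μ y
      = vertexW r S μ y + fun x z a b => ∑' w, φ μ y w * divV S w x z a b := by
  have hsum : ∀ (F : (Fin (d + 1) → ℤ) → ℝ) (M : ℝ), (∀ v, |F v| ≤ M) → ∀ (g : (Fin (d + 1) → ℤ) → ℝ), Summable g →
      Summable fun v => g v * F v := by
    intro F M hF g hg
    refine Summable.of_norm_bounded (hg.abs.mul_right M) fun v => ?_
    rw [Real.norm_eq_abs, abs_mul]
    exact mul_le_mul_of_nonneg_left (hF v) (abs_nonneg _)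
  have h₁ : ∀ κ x z a b, Summable fun v => r μ y κ v * S κ v x z a b := fun κ x z a b =>
    hsum (fun v => S κ v x z a b) CS (fun v => hS κ v x z a b) _ (hrs μ y κ)
  have h₂ : ∀ κ x z a b, Summable fun v => (φ μ y (v + unitVec κ) - φ μ y v) * S κ v x z a b := fun κ x z a b =>
    hsum (fun v => S κ v x z a b) CS (fun v => hS κ v x z a b) _ (((hφ μ y).comp_injective (add_left_injective (unitVec κ))).sub (hφ μ y))
  rw [vertexW_add_legs (r₁ := r) (r₂ := fun μ y κ v => φ μ y (v + unitVec κ) - φ μ y v) h₁ h₂, vertexW_gaugeLeg hφ hS μ y]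

/-! ## §3 Both slots dressed: the double vertex splits into the smooth double vertex and three gauge pairings -/

/-- [folklore] The vertex is additive in the TABLE when the leg is summable against both parts. -/
theorem vertexW_add_table {r : Fin (d + 1) → (Fin (d + 1) → ℤ) → Fin (d + 1) → (Fin (d + 1) → ℤ) → ℝ}
    {A B : Fin (d + 1) → (Fin (d + 1) → ℤ) → MKer (d + 1) (Fib d)} {μ : Fin (d + 1)} {y : Fin (d + 1) → ℤ}
    (hA : ∀ κ x z a b, Summable fun v => r μ y κ v * A κ v x z a b) (hB : ∀ κ x z a b, Summable fun v => r μ y κ v * B κ v x z a b) :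
    vertexW r (fun κ v => A κ v + B κ v) μ y = vertexW r A μ y + vertexW r B μ y := by
  funext x z a b
  simp only [vertexW_apply, Pi.add_apply, ← Finset.sum_add_distrib]
  refine Finset.sum_congr rfl fun κ _ => ?_
  rw [← (hA κ x z a b).tsum_add (hB κ x z a b)]
  exact tsum_congr fun v => by ring

/-- NOT IN PRINT; OUR BOOKKEEPING.  **BOTH SLOTS DRESSED — THE DOUBLE VERTEX SPLITS**: for a leg family `r` summable in its fine index, a gauge
potential `φ` summable in the fine slot position (per coarse bond), and a bounded table `X`:
`vertex2W (r + dz φ) X μ y ν y′ = vertex2W r X μ y ν y′ + vertexW r P₂ μ y + Σ'_w φ μ y w • (divV (fun κ u ↦ vertexW r (X κ u) ν y′) w + divV P₂ w)`,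
`P₂ κ u := Σ'_{w′} φ ν y′ w′ • divV (X κ u) w′` (the second-slot gauge pairing) — the smooth double vertex plus THREE gauge pairings, each meeting a SLOT DIVERGENCE of
the table (`divV (X κ u)` = second bond; `divV` of a first-slot family = first bond).  The crude `sup × divergence-row` bounds of the three pairings and their
packaging for `legPush` are the next file. -/
theorem vertex2W_dressed_eq {r : Fin (d + 1) → (Fin (d + 1) → ℤ) → Fin (d + 1) → (Fin (d + 1) → ℤ) → ℝ}
    {φ : Fin (d + 1) → (Fin (d + 1) → ℤ) → (Fin (d + 1) → ℤ) → ℝ} {X : Fin (d + 1) → (Fin (d + 1) → ℤ) → Fin (d + 1) → (Fin (d + 1) → ℤ) → MKer (d + 1) (Fib d)}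
    {CX : ℝ} (hrs : ∀ μ y κ, Summable fun v => r μ y κ v) (hφ : ∀ μ y, Summable fun v => φ μ y v)
    (hX : ∀ κ u κ' u' x z a b, |X κ u κ' u' x z a b| ≤ CX) (μ : Fin (d + 1)) (y : Fin (d + 1) → ℤ) (ν : Fin (d + 1)) (y' : Fin (d + 1) → ℤ) :
    vertexW (fun μ y κ v => r μ y κ v + (φ μ y (v + unitVec κ) - φ μ y v))
        (fun κ u => vertexW (fun μ y κ v => r μ y κ v + (φ μ y (v + unitVec κ) - φ μ y v)) (X κ u) ν y') μ y
      = vertexW r (fun κ u => vertexW r (X κ u) ν y') μ y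
        + vertexW r (fun κ u => fun x z a b => ∑' w', φ ν y' w' * divV (X κ u) w' x z a b) μ y
        + (fun x z a b => ∑' w, φ μ y w *
            (divV (fun κ u => vertexW r (X κ u) ν y') w
              + divV (fun κ u => fun x z a b => ∑' w', φ ν y' w' * divV (X κ u) w' x z a b) w) x z a b) := by
  have hCX : 0 ≤ CX := (abs_nonneg _).trans (hX 0 0 0 0 0 0 (Sum.inl 0) (Sum.inl 0))
  have hsum : ∀ (F : (Fin (d + 1) → ℤ) → ℝ) (M : ℝ), (∀ v, |F v| ≤ M) → ∀ (g : (Fin (d + 1) → ℤ) → ℝ), Summable g →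
      Summable fun v => g v * F v := by
    intro F M hF g hg
    refine Summable.of_norm_bounded (hg.abs.mul_right M) fun v => ?_
    rw [Real.norm_eq_abs, abs_mul]
    exact mul_le_mul_of_nonneg_left (hF v) (abs_nonneg _)
  -- inner split, slice by slice
  have hin : ∀ κ u, vertexW (fun μ y κ v => r μ y κ v + (φ μ y (v + unitVec κ) - φ μ y v)) (X κ u) ν y'
      = vertexW r (X κ u) ν y' + fun x z a b => ∑' w', φ ν y' w' * divV (X κ u) w' x z a b :=
    fun κ u => vertexW_dressed_eq hrs hφ (fun κ' v x z a b => hX κ u κ' v x z a b) ν y'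
  have e1 : (fun κ u => vertexW (fun μ y κ v => r μ y κ v + (φ μ y (v + unitVec κ) - φ μ y v)) (X κ u) ν y')
      = fun κ u => vertexW r (X κ u) ν y' + fun x z a b => ∑' w', φ ν y' w' * divV (X κ u) w' x z a b := by
    funext κ u; exact hin κ u
  rw [e1]
  -- bounds of the two inner parts (uniform), for the outer summabilities
  have hVb : ∀ κ u x z a b, |vertexW r (X κ u) ν y' x z a b| ≤ (∑ κ', ∑' u', |r ν y' κ' u'|) * CX :=
    fun κ u x z a b => LegPushNestAux.abs_vertexW_le_of_bdd (r := r) (T := X κ u) hrs (fun l' v' w z f b => hX κ u l' v' w z f b) ν y' x z a b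
  have hdivb : ∀ κ u w' x z a b, |divV (X κ u) w' x z a b| ≤ ((d : ℝ) + 1) * (CX + CX) := by
    intro κ u w' x z a b
    rw [divV_apply_entry]
    refine (Finset.abs_sum_le_sum_abs _ _).trans ?_
    calc ∑ κ', |X κ u κ' (w' - unitVec κ') x z a b - X κ u κ' w' x z a b| ≤ ∑ _κ' : Fin (d + 1), (CX + CX) :=
          Finset.sum_le_sum fun κ' _ => (abs_sub _ _).trans (add_le_add (hX _ _ _ _ _ _ _ _) (hX _ _ _ _ _ _ _ _))
      _ = ((d : ℝ) + 1) * (CX + CX) := by rw [Finset.sum_const, Finset.card_univ, Fintype.card_fin, nsmul_eq_mul]; push_cast; ring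
  have hPb : ∀ κ u x z a b, |∑' w', φ ν y' w' * divV (X κ u) w' x z a b| ≤ (∑' w', |φ ν y' w'|) * (((d : ℝ) + 1) * (CX + CX)) := by
    intro κ u x z a b
    have hs := (hφ ν y').abs.mul_right (((d : ℝ) + 1) * (CX + CX))
    have hb := tsum_of_norm_bounded hs.hasSum (f := fun w' => φ ν y' w' * divV (X κ u) w' x z a b) fun w' => by
      rw [Real.norm_eq_abs, abs_mul]; exact mul_le_mul_of_nonneg_left (hdivb κ u w' x z a b) (abs_nonneg _)
    rw [Real.norm_eq_abs, tsum_mul_right] at hb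
    exact hb
  -- outer split
  rw [vertexW_dressed_eq (S := fun κ u => vertexW r (X κ u) ν y' + fun x z a b => ∑' w', φ ν y' w' * divV (X κ u) w' x z a b)
    (CS := (∑ κ', ∑' u', |r ν y' κ' u'|) * CX + (∑' w', |φ ν y' w'|) * (((d : ℝ) + 1) * (CX + CX))) hrs hφ
    (fun κ v x z a b => by
      simp only [Pi.add_apply]
      exact (abs_add_le _ _).trans (add_le_add (hVb κ v x z a b) (hPb κ v x z a b))) μ y,
    vertexW_add_table (fun κ x z a b => hsum _ _ (fun v => hVb κ v x z a b) _ (hrs μ y κ))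
      (fun κ x z a b => hsum _ _ (fun v => hPb κ v x z a b) _ (hrs μ y κ)),
    show (fun κ v => vertexW r (X κ v) ν y' + fun x z a b => ∑' w', φ ν y' w' * divV (X κ v) w' x z a b)
      = fun κ v => (fun κ v => vertexW r (X κ v) ν y') κ v + (fun κ v => fun x z a b => ∑' w', φ ν y' w' * divV (X κ v) w' x z a b) κ v from rfl]
  congr 1
  funext x z a b
  refine tsum_congr fun w => ?_
  rw [divV_add]

end Summit.QuantumFields.BalabanUV.Beta.GAN24.LegPushGaugeSplit

end
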